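import Summits.QuantumFields.YangMills.Theorems.UnitScaleTiltProp8ChartDoubleBarDiffBall
import Summits.QuantumFields.YangMills.Theorems.UnitScaleTiltProp8ChartDoubleBarOneStep
import Summits.QuantumFields.YangMills.Theorems.UnitScaleTiltProp8ChartQuadraticWeighted
import HarnessLib

/-!
# Route `UnitScaleTilt`, crux K1 «MinimiserStabilityRegPr» (stmt-QuantumFields-19200), stub V2′ `stub_halvingStep` (H), RULING g26-№6∕№7 (S3) brick **B3**:
# **THE k-UNIFORM QUADRATIC REMAINDER OF THE DOUBLE-BAR CONSTRAINT MAP `chartLogFlat` — `hCd♭ ∧ hCq♭`** ([Balaban1985Variational] (44) for the chart of record;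
# the ♭ twin of `Prop8Chart.chartRemainder_hCd_hCq`)

Cell `ym3-torus` (HUMAN RULING D-0037: YM ladder rung R3 — not the Clay problem), width seat `ym-ust-19200-w3` gen 4 ((S3) hand B3 under LEAD ★w5-19200 g3).
`--supports stmt-QuantumFields-19200 --as helper`; def-free, 0 sorry.

INPUTS BY NAME.  B2 (✓p612034, LEAD ★w5-19200 g3) `Prop8ChartDoubleBar.differentiableOn_chartLogFlat_weightedBall` (hCd♭ on the weighted ball of radius `R′` with
`16·C₁·ℓ²·L·R′ ≤ 1`, `ℓ = (d+2)L`) and `Prop8ChartDoubleBar.norm_chartLogFlat_le_weightedBall` (the sup letter `‖Q♭(A)(j,c)‖ ≤ 8·L·R′` there — no comb factor), both over the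
displayed one-step letter `hstep` (B1 ✓p611670 `Prop8ChartDoubleBar.norm_dbarAvgU_sub_one_le`, `C₁ = 3800`); the generic Cauchy-on-a-complex-line step ✓p611856
`ChartQuadraticWeighted.norm_sub_fderiv_le_weightedBall`; `chartLogFlat_zero` (✓p610309).

WHAT THIS FILE PROVES (theorems only):
* §1 ★ `norm_chartLogFlat_sub_fderiv_le_weightedBall` — for a member `F`, heights `n, K`, a nested family `D` with `D.k = K − n` and the collar property, level weights, the
  displayed `hstep` (`2 ≤ C₁`), a radius `R′ > 0` with `16C₁ℓ²LR′ ≤ 1`, every `Y` of weighted size `≤ r`, `0 ≤ r`, `4r ≤ R′`, and every index `i`: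
  `‖chartLogFlat η D Y i − (fderiv ℂ (chartLogFlat η D) 0) Y i‖ ≤ (64L∕R′)·r²` (`= 8·(8LR′)∕R′²·r²`; `η = L^{−(K−n)}`).
* §2 ★★ `chartRemainderFlat_hCd_hCq` — the two P3a conjuncts for the ♭ chart at every `Adm22 D R′ M` family (`2L ≤ R′`, `1 ≤ M`), `hstep` displayed:
  `R⋆♭ := (16C₁ℓ²L)⁻¹`, hCd♭ on the ball of radius `R⋆♭∕4`, hCq♭ with `C₂♭ := 64L∕R⋆♭` for `r < R⋆♭∕4` — constants in `L`, `ℓ`, `C₁` only (no `j`, no `k`).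
* §3 ★★★ `chartRemainderFlat_hCd_hCq_B1` — §2 with `hstep` DISCHARGED by B1 (`C₁ = 3800`): `R⋆♭ = (60800ℓ²L)⁻¹`, `C₂♭ = 64L·60800ℓ²L`.  With (S1b) CERT-2
  (`fderiv (chartLogFlat η D) 0 = η·Lʲ·Q_j`) and (S5) `FlatHDressingShape.exists_flatH_scaledExt` (print's `H`), these are ALL THREE `ChartRemainderAt`-type letters of the
  re-based chart; the (S6) `obtain` of ✓`Chart47AnalyticCarrier.exists_analytic_chartD_of_remainder_T3` takes `hΦd`∕`hΦq` from here.
HONEST SCOPE: composition of the cell's own bricks; nothing of Bałaban's estimates beyond them is asserted; NOT a claim about the stub, the crux, the rung or the mass gap.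

References: T. Bałaban, CMP **102** (1985) 277–309 [Balaban1985Variational] ((20) p.281, (44)–(48) p.285, (156)–(157) p.302); CMP **98** (1985) 17–51
[Balaban1985Averaging] (Props. 3–4 pp.36–38, (127) p.36).
-/

set_option autoImplicit false

noncomputable section

open scoped BigOperators Matrix.Norms.L2Operator
open NormedSpace Metric Set

namespace Summit.QuantumFields.YangMills.Theorems.Prop8ChartDoubleBar

open Literature.MathematicalPhysics.QuantumFieldTheory.Balaban1983to89
open T4Continuum BlockAveraging
open B6SectADomainsV1 (Domains)
open B6SectAOperatorsV1 (BondIdx)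
open T3ContinuumYM3Torus (T3Family)
open Summit.QuantumFields.YangMills.Theorems.FlatCubeOpsText (Adm22 IsLevWeight)
open Summit.QuantumFields.YangMills.Theorems.Prop8Chart (collar_of_adm22)
open Summit.QuantumFields.YangMills.Theorems.ChartQuadraticWeighted (norm_sub_fderiv_le_weightedBall)

/-! ## §1 The quadratic remainder on the weighted ball -/

/-- **hCq♭ ON THE WEIGHTED BALL**: for a member `F`, heights `n, K`, a nested family `D` with `D.k = K − n` and the collar property, the level weights `w`, the displayed
one-step letter `hstep` (`2 ≤ C₁`), a radius `R′ > 0` with `16·C₁·ℓ²·L·R′ ≤ 1`, and every `Y` with `w 1 b·‖Y b‖ ≤ r` for all `b`, `0 ≤ r`, `4r ≤ R′`: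
`‖Q♭(Y)(i) − (DQ♭(0) Y)(i)‖ ≤ (64L∕R′)·r²` at every index `i` (`Q♭ = chartLogFlat η D`, `η = L^{−(K−n)}`).
[cite: Balaban1985Variational, (44) p.285, (47)-(48) p.285; Balaban1985Averaging, Prop. 4 (134)-(135) p.38] -/
theorem norm_chartLogFlat_sub_fderiv_le_weightedBall (F : T3Family) (n K : ℕ) (D : Domains (F.P K)) (hDk : D.k = K - n)
    (hcollar : ∀ (i : ℕ) (e : PBond (F.P K) (i + 1)), D.LamBond (i + 1) e → ∀ z : Site (F.P K) i, (blockOf z = e.src ∨ blockOf z = e.tgt) → z ∈ D.Om i)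
    {w : ℕ → PBond (F.P K) 0 → ℝ} (hw : IsLevWeight F n K D w) {C₁ : ℝ} (hC₁ : 2 ≤ C₁)
    (hstep : ∀ (j : ℕ), j + 1 ≤ (F.P K).m + (F.P K).K → ∀ (S : GaugeField (F.P K) j (Matrix (Fin 2) (Fin 2) ℂ)ˣ) (c : PBond (F.P K) (j + 1)) (s : ℝ), 0 ≤ s →
      48 * ((((F.P K).d + 2) * (F.P K).L : ℕ) : ℝ) * s ≤ 1 →
      (∀ b : PBond (F.P K) j, (blockOf b.src = c.src ∨ blockOf b.src = c.tgt) → (blockOf b.tgt = c.src ∨ blockOf b.tgt = c.tgt) →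
        ‖((S b : (Matrix (Fin 2) (Fin 2) ℂ)ˣ) : Matrix (Fin 2) (Fin 2) ℂ) - 1‖ ≤ s) →
      ‖((dbarAvgU S c : (Matrix (Fin 2) (Fin 2) ℂ)ˣ) : Matrix (Fin 2) (Fin 2) ℂ) - 1‖ ≤ ((F.P K).L : ℝ) * s + C₁ * ((((F.P K).d + 2) * (F.P K).L : ℕ) : ℝ) ^ 2 * s ^ 2)
    {R' : ℝ} (hR' : 16 * C₁ * ((((F.P K).d + 2) * (F.P K).L : ℕ) : ℝ) ^ 2 * (F.L : ℝ) * R' ≤ 1) (hR'0 : 0 < R')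
    (Y : PBond (F.P K) 0 → Matrix (Fin 2) (Fin 2) ℂ) {r : ℝ} (hr0 : 0 ≤ r) (hr : 4 * r ≤ R') (hY : ∀ b, w 1 b * ‖Y b‖ ≤ r) (i : BondIdx D) :
    ‖chartLogFlat (((F.L : ℝ)⁻¹) ^ (K - n)) D Y i -
        (fderiv ℂ (chartLogFlat (((F.L : ℝ)⁻¹) ^ (K - n)) D :
          (PBond (F.P K) 0 → Matrix (Fin 2) (Fin 2) ℂ) → BondIdx D → Matrix (Fin 2) (Fin 2) ℂ) 0) Y i‖ ≤ 64 * (F.L : ℝ) / R' * r ^ 2 := by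
  have hwpos : ∀ b, 0 < w 1 b := fun b => by
    rw [hw 1 b, pow_one]
    have hL : (0 : ℝ) < F.L := by exact_mod_cast (F.P K).L_pos
    positivity
  have hGd := differentiableOn_chartLogFlat_weightedBall F n K D hDk hcollar hw hC₁ hstep hR'
  have hGB : ∀ A : PBond (F.P K) 0 → Matrix (Fin 2) (Fin 2) ℂ, (∀ b, w 1 b * ‖A b‖ < R') → ∀ idx : BondIdx D,
      ‖chartLogFlat (((F.L : ℝ)⁻¹) ^ (K - n)) D A idx‖ ≤ 8 * (F.L : ℝ) * R' := fun A hA idx =>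
    norm_chartLogFlat_le_weightedBall F n K D hDk hcollar hw hC₁ hstep hR' hA idx
  have h := norm_sub_fderiv_le_weightedBall (w 1) hwpos
    (chartLogFlat (((F.L : ℝ)⁻¹) ^ (K - n)) D : (PBond (F.P K) 0 → Matrix (Fin 2) (Fin 2) ℂ) → BondIdx D → Matrix (Fin 2) (Fin 2) ℂ)
    (chartLogFlat_zero _ D) hR'0 hGd hGB Y hr0 hr hY i
  refine h.trans (le_of_eq ?_)
  field_simp
  ring

/-! ## §2 hCd♭ ∧ hCq♭ at an admissible family, `hstep` displayed -/

/-- **hCd♭ ∧ hCq♭ OF THE RE-BASED CHART, ASSEMBLED** with constants in `L`, `ℓ`, `C₁` only: for every member `F`, heights `n, K`, every `R′ ≥ 2L`, `M ≥ 1`, every nested family `D`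
with `D.k = K − n` admissible `Adm22 D R′ M`, the level weights, and the displayed one-step letter `hstep` (`2 ≤ C₁`): with `R⋆♭ := (16C₁ℓ²L)⁻¹`, the map `chartLogFlat η D`
is ℂ-differentiable on the weighted ball of radius `R⋆♭∕4` and `‖Q♭(Y)(i) − DQ♭(0)Y(i)‖ ≤ (64L∕R⋆♭)·r²` whenever `w 1 b·‖Y b‖ ≤ r` for all `b` and `r < R⋆♭∕4`.
[cite: Balaban1985Variational, (44)-(48) p.285, (156)-(157) p.302] -/
theorem chartRemainderFlat_hCd_hCq (F : T3Family) (n K : ℕ) {R' M : ℕ} (hR'L : 2 * (F.P K).L ≤ R') (hM : 1 ≤ M) (D : Domains (F.P K))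
    (hDk : D.k = K - n) (hAdm : Adm22 D R' M) {w : ℕ → PBond (F.P K) 0 → ℝ} (hw : IsLevWeight F n K D w) {C₁ : ℝ} (hC₁ : 2 ≤ C₁)
    (hstep : ∀ (j : ℕ), j + 1 ≤ (F.P K).m + (F.P K).K → ∀ (S : GaugeField (F.P K) j (Matrix (Fin 2) (Fin 2) ℂ)ˣ) (c : PBond (F.P K) (j + 1)) (s : ℝ), 0 ≤ s →
      48 * ((((F.P K).d + 2) * (F.P K).L : ℕ) : ℝ) * s ≤ 1 →
      (∀ b : PBond (F.P K) j, (blockOf b.src = c.src ∨ blockOf b.src = c.tgt) → (blockOf b.tgt = c.src ∨ blockOf b.tgt = c.tgt) →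
        ‖((S b : (Matrix (Fin 2) (Fin 2) ℂ)ˣ) : Matrix (Fin 2) (Fin 2) ℂ) - 1‖ ≤ s) →
      ‖((dbarAvgU S c : (Matrix (Fin 2) (Fin 2) ℂ)ˣ) : Matrix (Fin 2) (Fin 2) ℂ) - 1‖ ≤ ((F.P K).L : ℝ) * s + C₁ * ((((F.P K).d + 2) * (F.P K).L : ℕ) : ℝ) ^ 2 * s ^ 2) :
    let Rs : ℝ := (16 * C₁ * ((((F.P K).d + 2) * (F.P K).L : ℕ) : ℝ) ^ 2 * (F.L : ℝ))⁻¹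
    DifferentiableOn ℂ
        (chartLogFlat (((F.L : ℝ)⁻¹) ^ (K - n)) D :
          (PBond (F.P K) 0 → Matrix (Fin 2) (Fin 2) ℂ) → BondIdx D → Matrix (Fin 2) (Fin 2) ℂ)
        {Y | ∀ b, w 1 b * ‖Y b‖ < Rs / 4} ∧
      ∀ (Y : PBond (F.P K) 0 → Matrix (Fin 2) (Fin 2) ℂ) (r : ℝ), r < Rs / 4 → (∀ b, w 1 b * ‖Y b‖ ≤ r) →
        ∀ i : BondIdx D,
          ‖chartLogFlat (((F.L : ℝ)⁻¹) ^ (K - n)) D Y i -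
              (fderiv ℂ (chartLogFlat (((F.L : ℝ)⁻¹) ^ (K - n)) D :
                (PBond (F.P K) 0 → Matrix (Fin 2) (Fin 2) ℂ) → BondIdx D → Matrix (Fin 2) (Fin 2) ℂ) 0) Y i‖ ≤
            (64 * (F.L : ℝ) / Rs) * r ^ 2 := by
  intro Rs
  have hL1 : (1 : ℝ) ≤ F.L := by exact_mod_cast (F.P K).L_pos
  have hℓ1 : (1 : ℝ) ≤ ((((F.P K).d + 2) * (F.P K).L : ℕ) : ℝ) := by
    exact_mod_cast Nat.one_le_iff_ne_zero.mpr (Nat.mul_ne_zero (by omega) (by have := (F.P K).hL.2; omega))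
  have hC₁0 : (0 : ℝ) < C₁ := by linarith
  have hden : 0 < 16 * C₁ * ((((F.P K).d + 2) * (F.P K).L : ℕ) : ℝ) ^ 2 * (F.L : ℝ) := by positivity
  have hRs0 : 0 < Rs := inv_pos.mpr hden
  have hRs : 16 * C₁ * ((((F.P K).d + 2) * (F.P K).L : ℕ) : ℝ) ^ 2 * (F.L : ℝ) * Rs ≤ 1 := by
    show 16 * C₁ * ((((F.P K).d + 2) * (F.P K).L : ℕ) : ℝ) ^ 2 * (F.L : ℝ) *
      (16 * C₁ * ((((F.P K).d + 2) * (F.P K).L : ℕ) : ℝ) ^ 2 * (F.L : ℝ))⁻¹ ≤ 1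
    rw [mul_inv_cancel₀ hden.ne']
  have hRs4 : 16 * C₁ * ((((F.P K).d + 2) * (F.P K).L : ℕ) : ℝ) ^ 2 * (F.L : ℝ) * (Rs / 4) ≤ 1 := by
    have : Rs / 4 ≤ Rs := by linarith
    exact le_trans (mul_le_mul_of_nonneg_left this hden.le) hRs
  have hRM : 2 * (F.P K).L ≤ R' * M + 1 := by
    have : R' ≤ R' * M := Nat.le_mul_of_pos_right R' hM
    omega
  have hcollar := collar_of_adm22 D hAdm hRM
  refine ⟨differentiableOn_chartLogFlat_weightedBall F n K D hDk hcollar hw hC₁ hstep hRs4, fun Y r hr hY i => ?_⟩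
  rcases lt_or_ge r 0 with hneg | hr0
  · -- the size hypothesis at any bond contradicts `r < 0`
    exfalso
    have h := hY ⟨fun _ => 0, i.1.2.dir⟩
    have hw0 : 0 ≤ w 1 ⟨fun _ => 0, i.1.2.dir⟩ * ‖Y ⟨fun _ => 0, i.1.2.dir⟩‖ := by
      rw [hw 1, pow_one]
      have hL : (0 : ℝ) < F.L := by linarith
      exact mul_nonneg (by positivity) (norm_nonneg _)
    linarith
  exact norm_chartLogFlat_sub_fderiv_le_weightedBall F n K D hDk hcollar hw hC₁ hstep hRs hRs0 Y hr0 (by linarith) hY i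

/-! ## §3 `hstep` discharged by B1 (`C₁ = 3800`) -/

/-- **hCd♭ ∧ hCq♭ WITH THE ONE-STEP LETTER OF RECORD** (B1 `norm_dbarAvgU_sub_one_le`, `C₁ = 3800`): `R⋆♭ = (60800·ℓ²·L)⁻¹` (`ℓ = (d+2)L = 5L`), hCd♭ on the weighted ball
of radius `R⋆♭∕4`, hCq♭ with `C₂♭ = 64L∕R⋆♭` — k-UNIFORM, numerals and `L` only. [cite: Balaban1985Variational, (44)-(48) p.285; Balaban1985Averaging, Prop. 4 (134)-(135) p.38] -/
theorem chartRemainderFlat_hCd_hCq_B1 (F : T3Family) (n K : ℕ) {R' M : ℕ} (hR'L : 2 * (F.P K).L ≤ R') (hM : 1 ≤ M) (D : Domains (F.P K))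
    (hDk : D.k = K - n) (hAdm : Adm22 D R' M) {w : ℕ → PBond (F.P K) 0 → ℝ} (hw : IsLevWeight F n K D w) :
    let Rs : ℝ := (16 * 3800 * ((((F.P K).d + 2) * (F.P K).L : ℕ) : ℝ) ^ 2 * (F.L : ℝ))⁻¹
    DifferentiableOn ℂ
        (chartLogFlat (((F.L : ℝ)⁻¹) ^ (K - n)) D :
          (PBond (F.P K) 0 → Matrix (Fin 2) (Fin 2) ℂ) → BondIdx D → Matrix (Fin 2) (Fin 2) ℂ)
        {Y | ∀ b, w 1 b * ‖Y b‖ < Rs / 4} ∧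
      ∀ (Y : PBond (F.P K) 0 → Matrix (Fin 2) (Fin 2) ℂ) (r : ℝ), r < Rs / 4 → (∀ b, w 1 b * ‖Y b‖ ≤ r) →
        ∀ i : BondIdx D,
          ‖chartLogFlat (((F.L : ℝ)⁻¹) ^ (K - n)) D Y i -
              (fderiv ℂ (chartLogFlat (((F.L : ℝ)⁻¹) ^ (K - n)) D :
                (PBond (F.P K) 0 → Matrix (Fin 2) (Fin 2) ℂ) → BondIdx D → Matrix (Fin 2) (Fin 2) ℂ) 0) Y i‖ ≤
            (64 * (F.L : ℝ) / Rs) * r ^ 2 :=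
  chartRemainderFlat_hCd_hCq F n K hR'L hM D hDk hAdm hw (C₁ := 3800) (by norm_num)
    (fun j hj S c s hs0 hℓs hS => norm_dbarAvgU_sub_one_le hj c hs0 hℓs hS)

end Summit.QuantumFields.YangMills.Theorems.Prop8ChartDoubleBar

end
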